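import Summits.KontsevichZagierPeriods.KontsevichZagierPeriods.Theses.ComplexOrientations
import Literature.NumberTheory.Transcendental.KZDilationMove
import Literature.NumberTheory.Transcendental.KZSubcalculusInvariants
import Literature.NumberTheory.Transcendental.KZLogCalculusProofs
import Literature.NumberTheory.Transcendental.KZBallPeeling

/-!
# `OvalSector` (crux stmt-KontsevichZagierPeriods-11369), line `birth` — the DISC SECTOR

Route `KontsevichZagierPeriods/ComplexOrientations`, crux `OvalSector`. This file closes the two
calculus stubs of the registered skeleton `Lines/birth.lean` that speak of discs only:

* `stub_discSector` — for real-algebraic radii² `cᵢ ≥ 0`, `β ≥ 0`, integrand-1 representations `dᵢ`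
  over the centred open discs of radius² `cᵢ`, `e` over the centred open disc of radius² `β`, and
  ANY integer vector `n` with `Σ nᵢ·Area(dᵢ) = Area(e)`: `Σ nᵢ[dᵢ] − [e] ∈ KZ.relations`;
* `stub_discMultiple` — `m·[disc β] − [disc mβ] ∈ KZ.relations`.

The chain (Kontsevich–Zagier 2001, §1.2, rules (1) and (2) only): one rule-2 DILATION by `√c`
turns the integrand-1 disc of radius² `c > 0` into the unit disc `D` with the CONSTANT integrand `c`
(`of_disc_sub_of_constMul_mem_relations`, via `KZ.smul_sub_mem_relations`; `c = 0` is a null disc);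
soundness of these moves and `Area(D) ≠ 0` turn the value hypothesis into the scalar identity
`Σ nᵢcᵢ = β`; and integer-linear combinations of constant multiples of ONE representation are
integrand additivity (rule 1b: `sum_zsmul_of_sub_of_mem_relations`, from
`KZ.IntegralRep.of_constMul_nat_sub_nsmul_mem_relations`). No area is computed (no `π` appears).

References: M. Kontsevich, D. Zagier, *Periods* (2001), §1.2 rules (1), (2);
A. Huber, S. Müller-Stach, *Periods and Nori Motives* (2017), §13.1.
-/

noncomputable section

open Set MeasureTheory MvPolynomial
open Literature.NumberTheory.Transcendental Literature.ModelTheory.ExponentialFields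
open Summit.KontsevichZagierPeriods.KontsevichZagierPeriods.Theses.ComplexOrientations

namespace Summit.KontsevichZagierPeriods.ComplexOrientations.OvalSector

/-! ### Rule (1b) bookkeeping: integer-linear combinations of constant multiples -/

/-- **Integer multiples are integrand additivity.** If `r'` has the domain of `r` and integrand
`k · (r.integrand)` on it (`k ∈ ℤ`), then `[r'] − k•[r] ∈ KZ.relations`: for `k ≥ 0` this is
`KZ.IntegralRep.of_constMul_nat_sub_nsmul_mem_relations` up to congruence, for `k < 0` one adds the
rule-1b relation `[σ, |k| f] + [σ, −|k| f]`. [cite: KontsevichZagier2001, §1.2 rule (1)] -/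
theorem of_sub_zsmul_of_mem_relations {n : ℕ} (r r' : KZ.IntegralRep n) (k : ℤ)
    (hd : r'.domain = r.domain)
    (h : ∀ x ∈ r.domain, r'.integrand x = (k : ℝ) * r.integrand x) :
    KZ.of r' - k • KZ.of r ∈ KZ.relations := by
  obtain ⟨m, rfl | rfl⟩ := Int.eq_nat_or_neg k
  · -- `k = m ≥ 0`: `r' ≡ [σ, m f]` and `[σ, m f] − m•[σ, f] ∈ relations`
    have h1 : KZ.of r' - KZ.of (r.constMul (m : ℝ) (isAlgebraic_nat m)) ∈ KZ.relations := by
      refine KZ.of_sub_of_mem_relations_of_eqOn (by rw [KZ.IntegralRep.domain_constMul, hd])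
        fun x hx => ?_
      rw [hd] at hx
      rw [KZ.IntegralRep.integrand_constMul, h x hx]
      push_cast
      ring
    have h2 := KZ.IntegralRep.of_constMul_nat_sub_nsmul_mem_relations r m
    have : KZ.of r' - ((m : ℕ) : ℤ) • KZ.of r =
        (KZ.of r' - KZ.of (r.constMul (m : ℝ) (isAlgebraic_nat m))) +
          (KZ.of (r.constMul (m : ℝ) (isAlgebraic_nat m)) - m • KZ.of r) := by
      rw [natCast_zsmul]
      abel
    rw [this]
    exact KZ.relations.add_mem h1 h2
  · -- `k = -m ≤ 0`: `[σ, m f] + r' ∈ relations` (opposite integrands) and `[σ, m f] − m•[σ, f]`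
    have h1 : KZ.of (r.constMul (m : ℝ) (isAlgebraic_nat m)) + KZ.of r' ∈ KZ.relations := by
      refine KZ.of_add_of_mem_relations_of_eqOn_neg (by rw [KZ.IntegralRep.domain_constMul, hd])
        fun x hx => ?_
      rw [KZ.IntegralRep.domain_constMul] at hx
      rw [h x hx, Pi.neg_apply, KZ.IntegralRep.integrand_constMul]
      push_cast
      ring
    have h2 := KZ.IntegralRep.of_constMul_nat_sub_nsmul_mem_relations r m
    have : KZ.of r' - (-((m : ℕ) : ℤ)) • KZ.of r =
        (KZ.of (r.constMul (m : ℝ) (isAlgebraic_nat m)) + KZ.of r') -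
          (KZ.of (r.constMul (m : ℝ) (isAlgebraic_nat m)) - m • KZ.of r) := by
      rw [neg_zsmul, natCast_zsmul]
      abel
    rw [this]
    exact KZ.relations.sub_mem h1 h2

/-- Finite sums of `ℤ`-multiples of real-algebraic numbers are real-algebraic. [folklore] -/
theorem isAlgebraic_sum_intCast_mul {ι : Type*} (s : Finset ι) (c : ι → ℤ) (a : ι → ℝ)
    (ha : ∀ i ∈ s, IsAlgebraic ℚ (a i)) : IsAlgebraic ℚ (∑ i ∈ s, (c i : ℝ) * a i) := by
  classical
  induction s using Finset.induction_on with
  | empty => simpa using isAlgebraic_zero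
  | insert j s hj ih =>
    rw [Finset.sum_insert hj]
    exact ((isAlgebraic_int (c j)).mul (ha j (Finset.mem_insert_self j s))).add
      (ih fun i hi => ha i (Finset.mem_insert_of_mem hi))

/-- **Integer-linear bookkeeping of constant multiples (rule 1b).** Fix a representation `D` and
representations `r i` (`i ∈ s`) with the domain of `D` and integrands `aᵢ · D.integrand` on it
(`aᵢ` real-algebraic). Then for every integer vector `c` and every representation `t` with the
domain of `D` and integrand `(Σ_{i ∈ s} cᵢaᵢ) · D.integrand` on it,
`Σ_{i ∈ s} cᵢ•[r i] − [t] ∈ KZ.relations` (induction on `s`: the empty sum is the zero integrand,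
the step is one integrand-additivity move plus `of_sub_zsmul_of_mem_relations`).
[cite: KontsevichZagier2001, §1.2 rule (1)] -/
theorem sum_zsmul_of_sub_of_mem_relations {n : ℕ} {ι : Type*} (s : Finset ι)
    (D : KZ.IntegralRep n) (r : ι → KZ.IntegralRep n) (a : ι → ℝ) (c : ι → ℤ)
    (hrd : ∀ i ∈ s, (r i).domain = D.domain)
    (hri : ∀ i ∈ s, ∀ x ∈ D.domain, (r i).integrand x = a i * D.integrand x)
    (ha : ∀ i ∈ s, IsAlgebraic ℚ (a i)) :
    ∀ t : KZ.IntegralRep n, t.domain = D.domain →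
      (∀ x ∈ D.domain, t.integrand x = (∑ i ∈ s, (c i : ℝ) * a i) * D.integrand x) →
      (∑ i ∈ s, c i • KZ.of (r i)) - KZ.of t ∈ KZ.relations := by
  classical
  induction s using Finset.induction_on with
  | empty =>
    intro t htd hti
    simp only [Finset.sum_empty, zero_mul, zero_sub] at hti ⊢
    refine KZ.relations.neg_mem (KZ.of_mem_relations_of_eqOn_zero t fun x hx => ?_)
    rw [htd] at hx
    simpa using hti x hx
  | insert j s hj ih =>
    intro t htd hti
    have hjs : j ∈ insert j s := Finset.mem_insert_self j s
    have hsub : ∀ i ∈ s, i ∈ insert j s := fun i hi => Finset.mem_insert_of_mem hi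
    -- the two summands of `t`'s integrand, as representations over the domain of `D`
    have halg₁ : IsAlgebraic ℚ (∑ i ∈ s, (c i : ℝ) * a i) :=
      isAlgebraic_sum_intCast_mul s c a fun i hi => ha i (hsub i hi)
    have halg₂ : IsAlgebraic ℚ ((c j : ℝ) * a j) := (isAlgebraic_int (c j)).mul (ha j hjs)
    set t₁ : KZ.IntegralRep n := D.constMul _ halg₁ with ht₁
    set t₂ : KZ.IntegralRep n := D.constMul _ halg₂ with ht₂
    -- rule 1b: `[t] − [t₂] − [t₁]`
    have h0 : KZ.of t - KZ.of t₂ - KZ.of t₁ ∈ KZ.relations := by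
      refine KZ.integrandAddRel_subset_relations ⟨n, t, t₂, t₁, ?_, ?_, fun x hx => ?_, rfl⟩
      · rw [ht₂, KZ.IntegralRep.domain_constMul, htd]
      · rw [ht₁, KZ.IntegralRep.domain_constMul, htd]
      · rw [htd] at hx
        rw [hti x hx, Finset.sum_insert hj, Pi.add_apply, ht₁, ht₂,
          KZ.IntegralRep.integrand_constMul, KZ.IntegralRep.integrand_constMul]
        ring
    -- induction hypothesis for `t₁`
    have h1 : (∑ i ∈ s, c i • KZ.of (r i)) - KZ.of t₁ ∈ KZ.relations :=
      ih (fun i hi => hrd i (hsub i hi)) (fun i hi => hri i (hsub i hi))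
        (fun i hi => ha i (hsub i hi)) t₁ (by rw [ht₁, KZ.IntegralRep.domain_constMul])
        (fun x _ => by rw [ht₁, KZ.IntegralRep.integrand_constMul])
    -- the new summand: `[t₂] − c_j•[r j]`
    have h2 : KZ.of t₂ - c j • KZ.of (r j) ∈ KZ.relations := by
      refine of_sub_zsmul_of_mem_relations (r j) t₂ (c j)
        (by rw [ht₂, KZ.IntegralRep.domain_constMul, hrd j hjs]) fun x hx => ?_
      rw [hrd j hjs] at hx
      rw [ht₂, KZ.IntegralRep.integrand_constMul, hri j hjs x hx]
      ring
    rw [Finset.sum_insert hj]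
    have : c j • KZ.of (r j) + (∑ i ∈ s, c i • KZ.of (r i)) - KZ.of t =
        ((∑ i ∈ s, c i • KZ.of (r i)) - KZ.of t₁) - (KZ.of t₂ - c j • KZ.of (r j)) -
          (KZ.of t - KZ.of t₂ - KZ.of t₁) := by
      abel
    rw [this]
    exact KZ.relations.sub_mem (KZ.relations.sub_mem h1 h2) h0

/-! ### Rule (2): a disc of radius² `c` with integrand `1` is the unit disc with integrand `c` -/

/-- **The dilation step.** For a real-algebraic `c ≥ 0`, an integrand-1 representation `d` over the
centred open disc of radius² `c` and an integrand-1 representation `D` over the centred open unit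
disc: `[d] − [D, c] ∈ KZ.relations`, where `[D, c] = D.constMul c` is the unit disc with the constant
integrand `c`. For `c > 0` this is ONE rule-2 move along the dilation `u ↦ √c • u` (Jacobian `c`,
`KZ.smul_sub_mem_relations`); for `c = 0` both representations are relations (null domain /
zero integrand). [cite: KontsevichZagier2001, §1.2 rule (2)] -/
theorem of_disc_sub_of_constMul_mem_relations (c : ℝ) (hc : IsAlgebraic ℚ c) (hc0 : 0 ≤ c)
    (d D : KZ.IntegralRep 2) (hd : d.domain = {v : Fin 2 → ℝ | v 0 ^ 2 + v 1 ^ 2 < c})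
    (hd1 : ∀ v ∈ d.domain, d.integrand v = 1)
    (hD : D.domain = {v : Fin 2 → ℝ | v 0 ^ 2 + v 1 ^ 2 < 1})
    (hD1 : ∀ v ∈ D.domain, D.integrand v = 1) :
    KZ.of d - KZ.of (D.constMul c hc) ∈ KZ.relations := by
  rcases hc0.eq_or_lt with h0 | hcpos
  · -- `c = 0`: the disc is empty and `[D, 0]` has the zero integrand
    subst h0
    have h1 : KZ.of d ∈ KZ.relations := by
      refine KZ.of_mem_relations_of_volume_eq_zero d ?_
      have hempty : d.domain = ∅ := by
        rw [hd]
        ext v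
        simp only [mem_setOf_eq, mem_empty_iff_false, iff_false, not_lt]
        positivity
      rw [hempty, measure_empty]
    have h2 : KZ.of (D.constMul 0 hc) ∈ KZ.relations :=
      KZ.of_mem_relations_of_eqOn_zero _ fun x _ => by simp
    exact KZ.relations.sub_mem h1 h2
  · -- `c > 0`: dilation by `√c` from `[D, c]` onto `[d]`
    have hsq : (√c) ^ 2 = c := Real.sq_sqrt hcpos.le
    have hs : IsAlgebraic ℚ (√c) := IsAlgebraic.of_pow two_pos (by rw [hsq]; exact hc)
    have hs0 : √c ≠ 0 := (Real.sqrt_pos.mpr hcpos).ne'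
    have hdom : d.domain = (fun u : Fin 2 → ℝ => √c • u) '' (D.constMul c hc).domain := by
      rw [KZ.IntegralRep.domain_constMul, hD, hd]
      ext v
      simp only [mem_setOf_eq, mem_image]
      constructor
      · intro hv
        refine ⟨(√c)⁻¹ • v, ?_, ?_⟩
        · simp only [Pi.smul_apply, smul_eq_mul, mul_pow, inv_pow, hsq]
          rw [← mul_add, inv_mul_lt_iff₀ hcpos, mul_one]
          exact hv
        · simp [smul_smul, mul_inv_cancel₀ hs0]
      · rintro ⟨u, hu, rfl⟩
        simp only [Pi.smul_apply, smul_eq_mul, mul_pow, hsq]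
        rw [← mul_add]
        calc c * (u 0 ^ 2 + u 1 ^ 2) < c * 1 := mul_lt_mul_of_pos_left hu hcpos
          _ = c := mul_one c
    have h := KZ.smul_sub_mem_relations hs hs0 (D.constMul c hc) d hdom fun x hx => by
      have hx' : √c • x ∈ d.domain := by
        rw [hdom]
        exact mem_image_of_mem _ hx
      rw [KZ.IntegralRep.domain_constMul] at hx
      rw [KZ.IntegralRep.integrand_constMul, hd1 _ hx']
      dsimp only
      rw [hD1 x hx, abs_of_nonneg (Real.sqrt_nonneg c), hsq]
      ring
    simpa using KZ.relations.neg_mem h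

/-- **The unit disc with integrand `1` exists** and has non-zero value (its domain is open,
non-empty and bounded). [cite: KontsevichZagier2001, §1.1] -/
theorem exists_unitDiscRep :
    ∃ D : KZ.IntegralRep 2, D.domain = {v : Fin 2 → ℝ | v 0 ^ 2 + v 1 ^ 2 < 1} ∧
      (∀ v ∈ D.domain, D.integrand v = 1) ∧ D.value ≠ 0 := by
  obtain ⟨D, hDd, hDi⟩ := KZ.BallPeeling.exists_ballRep 2 0
  have hD : D.domain = {v : Fin 2 → ℝ | v 0 ^ 2 + v 1 ^ 2 < 1} := by
    rw [hDd]
    ext v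
    simp [Fin.sum_univ_two]
  have hD1 : ∀ v ∈ D.domain, D.integrand v = 1 := fun v _ => by simp [hDi]
  refine ⟨D, hD, hD1, ?_⟩
  -- value = volume of the unit disc, which is positive and finite
  have hmeas : MeasurableSet D.domain := KZ.IntegralRep.measurableSet_domain_holds D
  have hval : D.value = (volume D.domain).toReal := by
    show ∫ x in D.domain, D.integrand x = (volume D.domain).toReal
    rw [setIntegral_congr_fun hmeas hD1, setIntegral_const, smul_eq_mul, mul_one]
    rfl
  have hint : IntegrableOn (fun _ => (1 : ℝ)) D.domain := D.integrableOn.congr_fun hD1 hmeas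
  have hfin : volume D.domain < ⊤ := by
    rcases (integrableOn_const_iff (C := (1 : ℝ))).1 hint with h | h
    · simp at h
    · exact h
  have hopen : IsOpen D.domain := by
    rw [hD]
    exact isOpen_lt (by fun_prop) continuous_const
  have hne : D.domain.Nonempty := ⟨0, by simp [hD]⟩
  have hpos : 0 < volume D.domain := hopen.measure_pos volume hne
  rw [hval]
  exact ENNReal.toReal_ne_zero.mpr ⟨hpos.ne', hfin.ne⟩

/-! ### The two registered stubs -/

/-- **Stub `stub_discSector`** (the whole disc sector is a chain). For real-algebraic radii²
`cᵢ ≥ 0` and `β ≥ 0`, integrand-1 representations `dᵢ` over the centred open discs of radius² `cᵢ`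
and `e` over the centred open disc of radius² `β`, and ANY integer vector `n` with
`Σ nᵢ·Area(dᵢ) = Area(e)`: `Σ nᵢ[dᵢ] − [e] ∈ KZ.relations`. Chain: `[dᵢ] ~ [D, cᵢ]`, `[e] ~ [D, β]`
by one dilation each (`of_disc_sub_of_constMul_mem_relations`); soundness and `Area(D) ≠ 0` give
`Σ nᵢcᵢ = β`; then `Σ nᵢ[D, cᵢ] − [D, β]` is rule-1b bookkeeping
(`sum_zsmul_of_sub_of_mem_relations`). [cite: KontsevichZagier2001, §1.2 rules (1), (2)] -/
theorem stub_discSector (k : ℕ) (c : Fin k → ℝ) (hc : ∀ i, IsAlgebraic ℚ (c i))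
    (hc0 : ∀ i, 0 ≤ c i) (d : Fin k → KZ.IntegralRep 2)
    (hd : ∀ i, (d i).domain = {v : Fin 2 → ℝ | v 0 ^ 2 + v 1 ^ 2 < c i})
    (hd1 : ∀ i, ∀ v ∈ (d i).domain, (d i).integrand v = 1)
    (n : Fin k → ℤ) (β : ℝ) (e : KZ.IntegralRep 2) (hβ : IsAlgebraic ℚ β) (hβ0 : 0 ≤ β)
    (hedom : e.domain = {v : Fin 2 → ℝ | v 0 ^ 2 + v 1 ^ 2 < β})
    (heint : ∀ v ∈ e.domain, e.integrand v = 1)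
    (hval : ∑ i, (n i : ℝ) * (d i).value = e.value) :
    (∑ i, n i • KZ.of (d i)) - KZ.of e ∈ KZ.relations := by
  obtain ⟨D, hD, hD1, hD0⟩ := exists_unitDiscRep
  -- each disc against the scaled unit disc
  have hr : ∀ i, KZ.of (d i) - KZ.of (D.constMul (c i) (hc i)) ∈ KZ.relations := fun i =>
    of_disc_sub_of_constMul_mem_relations (c i) (hc i) (hc0 i) (d i) D (hd i) (hd1 i) hD hD1
  have he : KZ.of e - KZ.of (D.constMul β hβ) ∈ KZ.relations :=
    of_disc_sub_of_constMul_mem_relations β hβ hβ0 e D hedom heint hD hD1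
  -- values, by soundness of the calculus
  have hvd : ∀ i, (d i).value = c i * D.value := fun i => by
    rw [KZ.Equivalent.value_eq_holds (hr i), KZ.IntegralRep.value_constMul]
  have hve : e.value = β * D.value := by
    rw [KZ.Equivalent.value_eq_holds he, KZ.IntegralRep.value_constMul]
  have hsum : ∑ i, (n i : ℝ) * c i = β := by
    have h : (∑ i, (n i : ℝ) * c i) * D.value = β * D.value := by
      rw [← hve, ← hval, Finset.sum_mul]
      exact Finset.sum_congr rfl fun i _ => by rw [hvd i, mul_assoc]
    exact mul_right_cancel₀ hD0 h
  -- bookkeeping on the unit disc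
  have hB : (∑ i, n i • KZ.of (D.constMul (c i) (hc i))) - KZ.of (D.constMul β hβ) ∈
      KZ.relations :=
    sum_zsmul_of_sub_of_mem_relations Finset.univ D (fun i => D.constMul (c i) (hc i)) c n
      (fun i _ => rfl) (fun i _ x _ => rfl) (fun i _ => hc i) (D.constMul β hβ) rfl
      (fun x _ => by rw [hsum, KZ.IntegralRep.integrand_constMul])
  -- assemble
  have hsplit : (∑ i, n i • KZ.of (d i)) - KZ.of e =
      (∑ i, n i • (KZ.of (d i) - KZ.of (D.constMul (c i) (hc i)))) +
        ((∑ i, n i • KZ.of (D.constMul (c i) (hc i))) - KZ.of (D.constMul β hβ)) -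
        (KZ.of e - KZ.of (D.constMul β hβ)) := by
    simp only [smul_sub, Finset.sum_sub_distrib]
    abel
  rw [hsplit]
  exact KZ.relations.sub_mem (KZ.relations.add_mem
    (KZ.relations.sum_mem fun i _ => KZ.relations.zsmul_mem (hr i) _) hB) he

/-- **Stub `stub_discMultiple`** (disc bookkeeping for the π-carriers). For `m ∈ ℕ` and a
real-algebraic `β ≥ 0`, `m` copies of the integrand-1 representation over the disc of radius² `β`
and the integrand-1 representation over the disc of radius² `m·β` differ by a relation:
`m·[e] − [e'] ∈ KZ.relations`. Chain: `[e] ~ [D, β]` and `[e'] ~ [D, mβ]` by one dilation each,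
and `[D, mβ] − m•[D, β]` is integrand additivity. [cite: KontsevichZagier2001, §1.2 rules (1), (2)] -/
theorem stub_discMultiple (m : ℕ) (β : ℝ) (hβ : IsAlgebraic ℚ β) (hβ0 : 0 ≤ β)
    (e e' : KZ.IntegralRep 2)
    (he : e.domain = {v : Fin 2 → ℝ | v 0 ^ 2 + v 1 ^ 2 < β})
    (he1 : ∀ v ∈ e.domain, e.integrand v = 1)
    (he' : e'.domain = {v : Fin 2 → ℝ | v 0 ^ 2 + v 1 ^ 2 < (m : ℝ) * β})
    (he'1 : ∀ v ∈ e'.domain, e'.integrand v = 1) :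
    m • KZ.of e - KZ.of e' ∈ KZ.relations := by
  obtain ⟨D, hD, hD1, -⟩ := exists_unitDiscRep
  have hmβ : IsAlgebraic ℚ ((m : ℝ) * β) := (isAlgebraic_nat m).mul hβ
  have h1 : KZ.of e - KZ.of (D.constMul β hβ) ∈ KZ.relations :=
    of_disc_sub_of_constMul_mem_relations β hβ hβ0 e D he he1 hD hD1
  have h2 : KZ.of e' - KZ.of (D.constMul ((m : ℝ) * β) hmβ) ∈ KZ.relations :=
    of_disc_sub_of_constMul_mem_relations _ hmβ (mul_nonneg (Nat.cast_nonneg m) hβ0) e' D he'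
      he'1 hD hD1
  have h3 : KZ.of (D.constMul ((m : ℝ) * β) hmβ) - (m : ℤ) • KZ.of (D.constMul β hβ) ∈
      KZ.relations :=
    of_sub_zsmul_of_mem_relations (D.constMul β hβ) (D.constMul ((m : ℝ) * β) hmβ) m rfl
      fun x _ => by simp [mul_assoc]
  have hsplit : m • KZ.of e - KZ.of e' =
      m • (KZ.of e - KZ.of (D.constMul β hβ)) -
        (KZ.of (D.constMul ((m : ℝ) * β) hmβ) - (m : ℤ) • KZ.of (D.constMul β hβ)) -
        (KZ.of e' - KZ.of (D.constMul ((m : ℝ) * β) hmβ)) := by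
    rw [natCast_zsmul, smul_sub]
    abel
  rw [hsplit]
  exact KZ.relations.sub_mem (KZ.relations.sub_mem (KZ.relations.nsmul_mem h1 m) h3) h2

end Summit.KontsevichZagierPeriods.ComplexOrientations.OvalSector

end
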